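import Summits.CriticalPhenomena.Ising3DConformalLimit.Theses.MonotoneBlocking
import Summits.CriticalPhenomena.Ising3DConformalLimit.Theorems.HyperoctahedralRPExistsScaleCovariantLimitBlockLimitsGiveCrux
import HarnessLib

/-!
# Strategist sketch — crux `MonotoneBlockingTwo` (item stmt-CriticalPhenomena-17054, route MonotoneBlocking)

Typed objects of the STRATEGY CENSUS (b1): the honest-def bridge `MonotoneBlockingTwo ↔ BM2Of (criticalTwoPoint 3)`,
the kernel-checked implication **BM₂ ⟹ item 6150 `TwoPointDoubling`** (through the landed vocabulary of the dead line
`monotone-blocking-port` of crux 1981), the regime split UV/FAR/IR with its (trivial) glue, the three strengthenings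
S1/S2/S3 as signatures, and the typed negation consequence. Nothing here is proposed to the tree; it is census evidence.
-/

noncomputable section

namespace Summit.CriticalPhenomena.Ising3DConformalLimit.Cruxes.MonotoneBlockingTwo.Strategist

open MeasureTheory Filter Set Finset
open scoped Topology BigOperators
open Literature.Probability.LatticeModels
open Summit.CriticalPhenomena.Ising3DConformalLimit.Theses
open Summit.CriticalPhenomena.Ising3DConformalLimit.Theses.MonotoneBlocking (MonotoneBlockingTwo)
open Summit.CriticalPhenomena.Ising3DConformalLimit.Cruxes.ExistsScaleCovariantLimit.MonotoneBlockingPort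

/-! ## §0 Honest defs and the `Iff.rfl` bridge -/

/-- Block covariance functional of an arbitrary kernel `G` on `ℤ³`: `bc_G(L,k) = Σ_{x,y ∈ [0,L)³} G(Lk + x − y)`
(the route's let-bound `bc` with `G = criticalTwoPoint 3`). -/
def bcOf (G : Site 3 → ℝ) (L : ℕ) (k : Site 3) : ℝ :=
  ∑ x ∈ cube L, ∑ y ∈ cube L, G ((L : ℤ) • k + x - y)

/-- The BM₂ SHAPE for an arbitrary kernel: `ρ_G(L;k) = bc_G(L,k)/bc_G(L,0)` non-decreasing in `L ≥ 1`, cross-multiplied. -/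
def BM2Of (G : Site 3 → ℝ) : Prop :=
  ∀ L : ℕ, 1 ≤ L → ∀ k : Site 3, bcOf G L k * bcOf G (L + 1) 0 ≤ bcOf G (L + 1) k * bcOf G L 0

/-- The crux is the BM₂ shape of the critical two-point function (definitional). -/
theorem monotoneBlockingTwo_iff : MonotoneBlockingTwo ↔ BM2Of (criticalTwoPoint 3) := Iff.rfl

/-- The route's `bc` is the dead line's `blockCov` (swap the two block sums). -/
theorem bcOf_eq_blockCov (L : ℕ) (k : Site 3) : bcOf (criticalTwoPoint 3) L k = blockCov L k := by
  unfold bcOf blockCov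
  rw [Finset.sum_comm]
  refine Finset.sum_congr rfl fun x _ => Finset.sum_congr rfl fun y _ => ?_
  congr 1
  abel

/-! ## §1 BM₂ ⟹ the dead line's eventual stub S1 ⟹ item 6150 (kernel-checked) -/

/-- One BM₂ step on the ratio `ρ(L;v) = C(L;v)/V(L)`. -/
theorem ratio_step (h : MonotoneBlockingTwo) (v : Site 3) {L : ℕ} (hL : 1 ≤ L) :
    blockCov L v / blockCov L 0 ≤ blockCov (L + 1) v / blockCov (L + 1) 0 := by
  have h1 := (monotoneBlockingTwo_iff.1 h) L hL v
  rw [bcOf_eq_blockCov, bcOf_eq_blockCov, bcOf_eq_blockCov, bcOf_eq_blockCov] at h1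
  rw [div_le_div_iff₀ (blockCov_zero_pos L hL) (blockCov_zero_pos (L + 1) (by omega))]
  linarith [h1]

/-- **BM₂ (all `L ≥ 1`) ⟹ `Sig.stub_monotoneBlockingTwo`** (the EVENTUAL form, research stub S1 of the dead line
`monotone-blocking-port` of crux stmt-CriticalPhenomena-1981): monotone from `L₀ = 1`. -/
theorem sig_stub_monotoneBlockingTwo_of (h : MonotoneBlockingTwo) : Sig.stub_monotoneBlockingTwo := by
  intro k _hk
  refine ⟨1, Or.inl ?_⟩
  intro a ha b _hb hab
  simp only [Set.mem_Ici] at ha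
  show critBlockMoment 2 a k ≤ critBlockMoment 2 b k
  rw [critBlockMoment_two, critBlockMoment_two]
  set v : Site 3 := k 1 - k 0 with hv
  have chain : ∀ n : ℕ, blockCov a v / blockCov a 0 ≤ blockCov (a + n) v / blockCov (a + n) 0 := by
    intro n
    induction n with
    | zero => exact le_rfl
    | succ n ih => exact ih.trans (ratio_step h v (L := a + n) (by omega))
  have := chain (b - a)
  rwa [Nat.add_sub_cancel' hab] at this

/-- **BM₂ ⟹ item 6150 `TwoPointDoubling`** (`∃ κ > 0, ∀ n ≥ 1, κ g(n) ≤ g(2n)`), by the LANDED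
`twoPointDoubling_of_monotoneBlockingTwo` (BlockLimitsGiveCrux, p128428). So every proof of the crux is a proof of 6150. -/
theorem twoPointDoubling_of_bm2 (h : MonotoneBlockingTwo) : MirrorHoelderCompactness.TwoPointDoubling :=
  twoPointDoubling_of_monotoneBlockingTwo (sig_stub_monotoneBlockingTwo_of h)

/-! ## §2 Decomposition — the best typed split (regimes), glued; recorded, NOT filed -/

/-- UV piece: finitely many inequalities among short-distance critical correlations (`L ≤ L₀`, `‖k‖∞ ≤ K₀`). -/
def BM2UV (L₀ K₀ : ℕ) : Prop :=
  ∀ L : ℕ, 1 ≤ L → L ≤ L₀ → ∀ k : Site 3, (∀ i, |k i| ≤ (K₀ : ℤ)) →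
    bcOf (criticalTwoPoint 3) L k * bcOf (criticalTwoPoint 3) (L + 1) 0 ≤
      bcOf (criticalTwoPoint 3) (L + 1) k * bcOf (criticalTwoPoint 3) L 0

/-- FAR piece: fixed small `L`, far offsets — a two-scale ratio bound on `G` at distances `L‖k‖` vs `(L+1)‖k‖`
with the sharp constant `(L+1)⁶bc(L,0)/(L⁶bc(L+1,0))`; at `L₀ = 1` it contains 6150 with an explicit constant. -/
def BM2Far (L₀ K₀ : ℕ) : Prop :=
  ∀ L : ℕ, 1 ≤ L → L ≤ L₀ → ∀ k : Site 3, (∃ i, (K₀ : ℤ) < |k i|) →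
    bcOf (criticalTwoPoint 3) L k * bcOf (criticalTwoPoint 3) (L + 1) 0 ≤
      bcOf (criticalTwoPoint 3) (L + 1) k * bcOf (criticalTwoPoint 3) L 0

/-- IR piece: eventual BM₂ UNIFORMLY in `k` (`L > L₀`): the sign of the leading correction to scaling in every
block channel. This piece alone is the whole crux minus finitely many numbers. -/
def BM2IR (L₀ : ℕ) : Prop :=
  ∀ L : ℕ, L₀ < L → ∀ k : Site 3,
    bcOf (criticalTwoPoint 3) L k * bcOf (criticalTwoPoint 3) (L + 1) 0 ≤
      bcOf (criticalTwoPoint 3) (L + 1) k * bcOf (criticalTwoPoint 3) L 0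

/-- The split is exhaustive (trivial glue). -/
theorem bm2_of_regimes (L₀ K₀ : ℕ) (hUV : BM2UV L₀ K₀) (hFar : BM2Far L₀ K₀) (hIR : BM2IR L₀) :
    MonotoneBlockingTwo := by
  rw [monotoneBlockingTwo_iff]
  intro L hL k
  rcases le_or_gt L L₀ with hle | hlt
  · by_cases hk : ∀ i, |k i| ≤ (K₀ : ℤ)
    · exact hUV L hL hle k hk
    · push Not at hk
      exact hFar L hL hle k hk
  · exact hIR L hlt k

/-! ## §3 Strengthen — the S⁺ signatures -/

/-- S1 (birth stub of the route planner): supercritical blocking, BM₂ in the plus state for EVERY `β > β_c(3)`. -/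
def SupercriticalBlocking : Prop :=
  ∀ β : ℝ, criticalBeta 3 < β → BM2Of (twoPointPlus 3 β)

/-- … and its soft companion: right-continuity of `β ↦ ⟨σ₀σ_x⟩⁺_β` at `β_c` (closed inequality passes to the limit). -/
def ThresholdTransfer : Prop :=
  ∀ x : Site 3, ContinuousWithinAt (fun β : ℝ => twoPointPlus 3 β x) (Set.Ici (criticalBeta 3)) (criticalBeta 3)

/-- S1 ∧ threshold ⟹ crux (the birth composition, re-typed over the route decl): stated, not proved here. -/
def BirthComposition : Prop := SupercriticalBlocking → ThresholdTransfer → MonotoneBlockingTwo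

/-- S2 (the card's spectral-smearing SS): the cross-multiplied increment matrix
`M_L(κ,κ') = bc(L+1,κ−κ')bc(L,0) − bc(L,κ−κ')bc(L+1,0)` is positive semi-definite for every `L ≥ 1`. -/
def PSDIncrements (G : Site 3 → ℝ) : Prop :=
  ∀ L : ℕ, 1 ≤ L → ∀ (s : Finset (Site 3)) (c : Site 3 → ℝ),
    0 ≤ ∑ κ ∈ s, ∑ κ' ∈ s, c κ * c κ' *
      (bcOf G (L + 1) (κ - κ') * bcOf G L 0 - bcOf G L (κ - κ') * bcOf G (L + 1) 0)

/-- S3 (this seat): the unit-cell-averaged Riesz kernel `K_a(x) = ∫∫_{[0,1]³×[0,1]³} |x+u−v|^{-a} du dv`, `0 < a < 3` —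
the covariance of unit-cell integrals of a continuum scale-invariant field, EXACTLY self-similar under integer blocking. -/
def rieszCell (a : ℝ) (x : Site 3) : ℝ :=
  ∫ u in Set.Icc (0 : Fin 3 → ℝ) 1, ∫ v in Set.Icc (0 : Fin 3 → ℝ) 1,
    Real.sqrt (∑ i, ((x i : ℝ) + u i - v i) ^ 2) ^ (-a)

/-- `G` is a positive mixture of cell-averaged Riesz kernels over exponents `a ∈ (0,3)` plus an on-site nugget `N ≥ 0`. -/
def RieszMixture (G : Site 3 → ℝ) : Prop :=
  ∃ (α : Measure ℝ) (N : ℝ), IsFiniteMeasure α ∧ α (Set.Ioo (0 : ℝ) 3)ᶜ = 0 ∧ 0 ≤ N ∧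
    ∀ x : Site 3, G x = (∫ a, rieszCell a x ∂α) + (if x = 0 then N else 0)

/-- The mixture-monotonicity theorem (statement; real analysis: `a ↦ ρ*_a(k)` antitone + monotone likelihood ratio):
every Riesz mixture satisfies the BM₂ shape for ALL `L ≥ 1` and all `k`. -/
def MixtureMonotone : Prop := ∀ G : Site 3 → ℝ, RieszMixture G → BM2Of G

/-- The transferred crux C⁺ of S3: the critical two-point function IS such a mixture (false at the lattice UV; see census). -/
def CriticalIsRieszMixture : Prop := RieszMixture (criticalTwoPoint 3)

/-- S3 composition (kernel-checked modus ponens through the `Iff.rfl` bridge). -/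
theorem bm2_of_mixture (h₁ : MixtureMonotone) (h₂ : CriticalIsRieszMixture) : MonotoneBlockingTwo :=
  monotoneBlockingTwo_iff.2 (h₁ _ h₂)

/-! ## §4 Negation — the typed rigorous consequence (refuter-runnable) -/

/-- BM₂ telescoped from `L = 1`: `G(k)·bc(M,0) ≤ bc(M,k)` for every `M ≥ 1` and `k` — the `L = 1` slice, a statement about
the FULL two-point function at two scales `‖k‖` and `M‖k‖` with the sharp constant `bc(M,0)`. -/
def LOneSlice : Prop :=
  ∀ M : ℕ, 1 ≤ M → ∀ k : Site 3,
    criticalTwoPoint 3 k * bcOf (criticalTwoPoint 3) M 0 ≤ bcOf (criticalTwoPoint 3) M k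

/-- BM₂ ⟹ the `L = 1` slice (telescoping the ratio inequality; `bc(1,k) = G(k)`, `bc(1,0) = 1`). -/
theorem lOneSlice_of_bm2 (h : MonotoneBlockingTwo) : LOneSlice := by
  intro M hM k
  have hb1k : bcOf (criticalTwoPoint 3) 1 k = criticalTwoPoint 3 k := by
    rw [bcOf_eq_blockCov]
    unfold blockCov
    have hc : cube 1 = {(0 : Site 3)} := by
      ext x
      rw [mem_cube, Finset.mem_singleton]
      constructor
      · intro hx
        funext i
        have := hx i
        simp only [Pi.zero_apply]
        omega
      · rintro rfl i
        simp
    rw [hc]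
    simp
  have hb10 : bcOf (criticalTwoPoint 3) 1 0 = 1 := by
    rw [bcOf_eq_blockCov]
    unfold blockCov
    have hc : cube 1 = {(0 : Site 3)} := by
      ext x
      rw [mem_cube, Finset.mem_singleton]
      constructor
      · intro hx
        funext i
        have := hx i
        simp only [Pi.zero_apply]
        omega
      · rintro rfl i
        simp
    rw [hc]
    simp [criticalTwoPoint_zero']
  -- ratio chain from 1 to M
  have hpos : ∀ L : ℕ, 1 ≤ L → 0 < bcOf (criticalTwoPoint 3) L 0 := fun L hL => by
    rw [bcOf_eq_blockCov]; exact blockCov_zero_pos L hL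
  have chain : ∀ n : ℕ, bcOf (criticalTwoPoint 3) 1 k / bcOf (criticalTwoPoint 3) 1 0 ≤
      bcOf (criticalTwoPoint 3) (1 + n) k / bcOf (criticalTwoPoint 3) (1 + n) 0 := by
    intro n
    induction n with
    | zero => exact le_rfl
    | succ n ih =>
      refine ih.trans ?_
      have step := (monotoneBlockingTwo_iff.1 h) (1 + n) (by omega) k
      rw [show 1 + (n + 1) = 1 + n + 1 by ring]
      rw [div_le_div_iff₀ (hpos (1 + n) (by omega)) (hpos (1 + n + 1) (by omega))]
      linarith [step]
  have hfin := chain (M - 1)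
  rw [show 1 + (M - 1) = M by omega, hb1k, hb10, div_one,
    le_div_iff₀ (hpos M hM)] at hfin
  linarith [hfin]

end Summit.CriticalPhenomena.Ising3DConformalLimit.Cruxes.MonotoneBlockingTwo.Strategist

end
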